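import Literature.Analysis.Asymptotics.PoincareRatioTheorem
import Summits.KontsevichZagierPeriods.Zeta5Search.Zudilin2003Casoratian
import HarnessLib

/-!
# ζ(5) search — EXACT growth rate of Zudilin's Catalan approximants by Poincaré's theorem (cell `pub-zeta5`, TYPER)

HONEST FRAMING: systematic search; no irrationality claim unless certified.

Catalan arm, sequel of `Zudilin2003Growth.lean` (kernel-certified ratio box
`15/2 ≤ u_{n+1}/uₙ ≤ 557/50`, `n ≥ 2`, for the denominators `uₙ` of Zudilin's 2003 second-order
recursion (2) for Catalan's constant, `Literature.NumberTheory.Irrationality.Zudilin2003.u`) and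
`Zudilin2003Casoratian.lean`. With the tree's Poincaré theorem under an a-priori bracket
(`Literature.Analysis.Asymptotics.PoincareRecurrence.tendsto_ratio_of_recurrence₂`, Elaydi Thm 7.10)
and Elaydi's Lemma 7.14 the box becomes an EXACT limit:

* `tendsto_sC`, `tendsto_tC` — the coefficients of `u_{m+2} = s_m u_{m+1} - t_m u_m` tend to
  `11` and `-1` (limiting equation `λ² = 11λ + 1`, Zudilin's characteristic polynomial, roots
  `((1 ± √5)/2)⁵`);
* `tendsto_ratio_uR` — `u_{n+1}/uₙ → ((1+√5)/2)⁵ = (11+5√5)/2 = 11.0901…` (contraction constant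
  `1/(15/2)² < 1`); `tendsto_log_u_div` — `log uₙ / n → log ((1+√5)/2)⁵ = 2.40605912…`;
* the same for the numerators `vₙ` (`vR_ratio_bounds`: the box `[15/2, 557/50]` again, initial
  ratios `v₃/v₂ = 7.5013…`), `tendsto_log_v_div`;
* `tendsto_root_u` — `uₙ^{1/n} → ((1+√5)/2)⁵`: literally the FIRST conjunct of the tree's NAMED FACT
  `Zudilin2003.rates` ("`lim u_n^{1/n} = ((1+√5)/2)⁵`", stated after Theorem 1 with a reference to
  Poincaré's theorem), now a THEOREM of the tree (unconditional, 0 sorry). The other two conjuncts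
  (`uₙG - vₙ ≠ 0` and the decay rate `((√5-1)/2)⁵`) are the analytic content and remain cited.
-/

noncomputable section

open Filter Topology Finset Set
open Literature.NumberTheory.Irrationality.Zudilin2003
open Literature.Analysis.Asymptotics.PoincareRecurrence

namespace Summit.KontsevichZagierPeriods.Zeta5Search

namespace Zudilin2003Growth

/-! ### Limits of the coefficients -/

/-- `1/(m+1) → 0` along `ℕ`. -/
private theorem tendsto_inv_succ : Tendsto (fun m : ℕ => (1 : ℝ) / ((m : ℝ) + 1)) atTop (𝓝 0) :=
  tendsto_one_div_add_atTop_nhds_zero_nat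

/-- **`s_m → 11`** (`s_m = q(m+1)/((2m+3)²(2m+4)²p(m+1))`, leading coefficients `3520 = 11·320`). -/
theorem tendsto_sC : Tendsto sC atTop (𝓝 11) := by
  set F : ℝ → ℝ := fun y => 3520 + 5632 * y + 2064 * y ^ 2 - 384 * y ^ 3 - 156 * y ^ 4 +
      16 * y ^ 5 + 7 * y ^ 6 with hF
  set G : ℝ → ℝ := fun y => (2 + y) ^ 2 * (2 + 2 * y) ^ 2 * (20 - 8 * y + y ^ 2) with hG
  have hGpos : ∀ m : ℕ, 0 < G (1 / ((m : ℝ) + 1)) := by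
    intro m
    have hm : (m : ℝ) + 1 ≠ 0 := by positivity
    have e : G (1 / ((m : ℝ) + 1)) = LC m / ((m : ℝ) + 1) ^ 6 := by
      rw [hG]; unfold LC; simp only [p]; field_simp; ring
    rw [e]; exact div_pos (LC_pos m) (by positivity)
  have hseq : ∀ m : ℕ, sC m = F (1 / ((m : ℝ) + 1)) / G (1 / ((m : ℝ) + 1)) := by
    intro m
    have hm : (m : ℝ) + 1 ≠ 0 := by positivity
    have hp : p ((m : ℝ) + 1) ≠ 0 := by rw [p_add_one]; positivity
    have h3 : 2 * (m : ℝ) + 3 ≠ 0 := by positivity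
    have h4 : 2 * (m : ℝ) + 4 ≠ 0 := by positivity
    rw [eq_div_iff (hGpos m).ne']
    unfold sC LC
    rw [hF, hG]
    simp only
    field_simp
    simp only [p, q]
    ring
  have hFc : Continuous F := by rw [hF]; fun_prop
  have hGc : Continuous G := by rw [hG]; fun_prop
  have hF0 : Tendsto (fun m : ℕ => F (1 / ((m : ℝ) + 1))) atTop (𝓝 (F 0)) :=
    (hFc.tendsto 0).comp tendsto_inv_succ
  have hG0 : Tendsto (fun m : ℕ => G (1 / ((m : ℝ) + 1))) atTop (𝓝 (G 0)) :=
    (hGc.tendsto 0).comp tendsto_inv_succ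
  have hG0ne : G 0 ≠ 0 := by rw [hG]; norm_num
  have hlim : F 0 / G 0 = 11 := by rw [hF, hG]; norm_num
  rw [← hlim]
  exact (hF0.div hG0 hG0ne).congr fun m => (hseq m).symm

/-- **`t_m → -1`** (`t_m = -(2m+1)²(2m+2)²p(m+2)/((2m+3)²(2m+4)²p(m+1))`). -/
theorem tendsto_tC : Tendsto tC atTop (𝓝 (-1)) := by
  set F : ℝ → ℝ := fun y => -((2 - y) ^ 2 * 2 ^ 2 * (20 * (1 + y) ^ 2 - 8 * (1 + y) * y + y ^ 2))
    with hF
  set G : ℝ → ℝ := fun y => (2 + y) ^ 2 * (2 + 2 * y) ^ 2 * (20 - 8 * y + y ^ 2) with hG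
  have hGpos : ∀ m : ℕ, 0 < G (1 / ((m : ℝ) + 1)) := by
    intro m
    have hm : (m : ℝ) + 1 ≠ 0 := by positivity
    have e : G (1 / ((m : ℝ) + 1)) = LC m / ((m : ℝ) + 1) ^ 6 := by
      rw [hG]; unfold LC; simp only [p]; field_simp; ring
    rw [e]; exact div_pos (LC_pos m) (by positivity)
  have hteq : ∀ m : ℕ, tC m = F (1 / ((m : ℝ) + 1)) / G (1 / ((m : ℝ) + 1)) := by
    intro m
    have hm : (m : ℝ) + 1 ≠ 0 := by positivity
    have hp : p ((m : ℝ) + 1) ≠ 0 := by rw [p_add_one]; positivity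
    have h3 : 2 * (m : ℝ) + 3 ≠ 0 := by positivity
    have h4 : 2 * (m : ℝ) + 4 ≠ 0 := by positivity
    rw [eq_div_iff (hGpos m).ne']
    unfold tC TC LC
    rw [hF, hG]
    simp only
    field_simp
    simp only [p]
    ring
  have hFc : Continuous F := by rw [hF]; fun_prop
  have hGc : Continuous G := by rw [hG]; fun_prop
  have hF0 : Tendsto (fun m : ℕ => F (1 / ((m : ℝ) + 1))) atTop (𝓝 (F 0)) :=
    (hFc.tendsto 0).comp tendsto_inv_succ
  have hG0 : Tendsto (fun m : ℕ => G (1 / ((m : ℝ) + 1))) atTop (𝓝 (G 0)) :=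
    (hGc.tendsto 0).comp tendsto_inv_succ
  have hG0ne : G 0 ≠ 0 := by rw [hG]; norm_num
  have hlim : F 0 / G 0 = -1 := by rw [hF, hG]; norm_num
  rw [← hlim]
  exact (hF0.div hG0 hG0ne).congr fun m => (hteq m).symm

/-! ### The dominant root `((1+√5)/2)⁵ = (11+5√5)/2` -/

/-- `2 < √5`. -/
theorem two_lt_sqrt_five : (2 : ℝ) < Real.sqrt 5 := by
  rw [show (2 : ℝ) = Real.sqrt 4 by rw [show (4 : ℝ) = 2 ^ 2 by norm_num, Real.sqrt_sq (by norm_num)]]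
  exact Real.sqrt_lt_sqrt (by norm_num) (by norm_num)

/-- `((1+√5)/2)⁵ = (11+5√5)/2` and it solves `λ² = 11λ + 1`. -/
theorem golden_fifth :
    ((1 + Real.sqrt 5) / 2) ^ 5 = (11 + 5 * Real.sqrt 5) / 2 ∧
      ((11 + 5 * Real.sqrt 5) / 2) ^ 2 = 11 * ((11 + 5 * Real.sqrt 5) / 2) - (-1) := by
  have hs : Real.sqrt 5 ^ 2 = 5 := Real.sq_sqrt (by norm_num)
  obtain ⟨hroot, hpow⟩ := charPoly_root (Real.sqrt 5) hs
  refine ⟨hpow, ?_⟩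
  unfold charPoly at hroot
  linear_combination hroot

/-! ### Poincaré: the ratio limit for any solution bracketed below by `15/2` -/

/-- **Poincaré's theorem applied**: any real solution `w` of (2) in solved form with `wₙ > 0` and
`(15/2) wₙ ≤ w_{n+1}` for `n ≥ 2` has `w_{n+1}/wₙ → ((1+√5)/2)⁵` (contraction constant `|−1|/(15/2)² < 1`;
`(11+5√5)/2 ≥ 15/2`). -/
theorem tendsto_ratio_of_bracket (w : ℕ → ℝ)
    (hrec : ∀ m, w (m + 2) = sC m * w (m + 1) - tC m * w m)
    (hbr : ∀ n, 2 ≤ n → 0 < w n ∧ 15 / 2 * w n ≤ w (n + 1)) :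
    Tendsto (fun n => w (n + 1) / w n) atTop (𝓝 (((1 + Real.sqrt 5) / 2) ^ 5)) := by
  obtain ⟨hpow, hchar⟩ := golden_fifth
  rw [hpow]
  refine tendsto_ratio_of_recurrence₂ w sC tC (L := 15 / 2) 2 (fun m _ => hrec m) tendsto_sC
    tendsto_tC (by norm_num) (fun n hn => (hbr n hn).1.ne') (fun n hn => ?_) hchar ?_ (by norm_num)
  · obtain ⟨hpos, hle⟩ := hbr n hn
    rwa [le_div_iff₀ hpos]
  · linarith [two_lt_sqrt_five]

/-- **Rate from ratio** for such a solution: `log wₙ / n → log ((1+√5)/2)⁵`. -/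
theorem tendsto_log_div_of_bracket (w : ℕ → ℝ)
    (hrec : ∀ m, w (m + 2) = sC m * w (m + 1) - tC m * w m)
    (hbr : ∀ n, 2 ≤ n → 0 < w n ∧ 15 / 2 * w n ≤ w (n + 1)) (hpos : ∀ n, 0 < w n) :
    Tendsto (fun n => Real.log (w n) / n) atTop (𝓝 (Real.log (((1 + Real.sqrt 5) / 2) ^ 5))) := by
  have hl0 : (0 : ℝ) < ((1 + Real.sqrt 5) / 2) ^ 5 := by
    have := two_lt_sqrt_five; positivity
  have h := tendsto_log_abs_div_of_tendsto_ratio w 2 (fun n hn => (hbr n hn).1.ne') hl0.ne'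
    (tendsto_ratio_of_bracket w hrec hbr)
  rw [abs_of_pos hl0] at h
  exact h.congr fun n => by rw [abs_of_pos (hpos n)]

/-! ### `uₙ` -/

/-- `uₙ > 0` for all `n` (tree: `u_pos_and_v_succ_pos`). -/
theorem uR_pos (n : ℕ) : 0 < uR n := by
  unfold uR; exact_mod_cast (u_pos_and_v_succ_pos n).1

/-- **Exact ratio limit**: `u_{n+1}/uₙ → ((1+√5)/2)⁵`. -/
theorem tendsto_ratio_uR :
    Tendsto (fun n => uR (n + 1) / uR n) atTop (𝓝 (((1 + Real.sqrt 5) / 2) ^ 5)) :=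
  tendsto_ratio_of_bracket uR uR_rec (fun n hn => ⟨(ratio_bounds n hn).1, (ratio_bounds n hn).2.1⟩)

/-- **Exact growth rate of `uₙ`**: `log uₙ / n → log ((1+√5)/2)⁵ = 5 log((1+√5)/2) = 2.40605912…`. -/
theorem tendsto_log_u_div :
    Tendsto (fun n : ℕ => Real.log (u n : ℝ) / n) atTop
      (𝓝 (Real.log (((1 + Real.sqrt 5) / 2) ^ 5))) :=
  tendsto_log_div_of_bracket uR uR_rec
    (fun n hn => ⟨(ratio_bounds n hn).1, (ratio_bounds n hn).2.1⟩) uR_pos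

/-! ### `vₙ`: the same box `[15/2, 557/50]` -/

/-- `v₂ = 10699/1152`. -/
theorem v_two : v 2 = 10699 / 1152 := by
  have h : v 2 = step 0 (v 0) (v 1) := by unfold v; exact sol_step _ _ 0
  rw [h]; unfold v; rw [sol_zero, sol_one]; norm_num [step, p, q]

/-- `v₃ = 8025653/115200`. -/
theorem v_three : v 3 = 8025653 / 115200 := by
  have h : v 3 = step 1 (v 1) (v 2) := by unfold v; exact sol_step _ _ 1
  rw [h, v_two]; unfold v; rw [sol_one]; norm_num [step, p, q]

/-- **Kernel-certified ratio bracket for the numerators**: for `n ≥ 2`, `vₙ > 0` and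
`(15/2) vₙ ≤ v_{n+1} ≤ (557/50) vₙ` (corner inequalities of `Zudilin2003Growth`, initial ratio
`v₃/v₂ = 7.5013…`). -/
theorem vR_ratio_bounds :
    ∀ n, 2 ≤ n → 0 < vR n ∧ 15 / 2 * vR n ≤ vR (n + 1) ∧ vR (n + 1) ≤ 557 / 50 * vR n := by
  refine ratio_bounds_of_recurrence_neg vR sC tC 2 (fun m _ => vR_rec m) (fun m _ => tC_nonpos m)
    (by norm_num) (by norm_num) (fun m hm => corner_low m hm) (fun m hm => corner_up m hm) ?_ ?_ ?_
  · unfold vR; rw [v_two]; norm_num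
  · unfold vR; rw [v_two, v_three]; norm_num
  · unfold vR; rw [v_two, v_three]; norm_num

/-- `vₙ > 0` for `n ≥ 1` (tree: `v_pos`). -/
theorem vR_pos {n : ℕ} (hn : 1 ≤ n) : 0 < vR n := by
  unfold vR; exact_mod_cast v_pos hn

/-- **Exact ratio limit for the numerators**: `v_{n+1}/vₙ → ((1+√5)/2)⁵`. -/
theorem tendsto_ratio_vR :
    Tendsto (fun n => vR (n + 1) / vR n) atTop (𝓝 (((1 + Real.sqrt 5) / 2) ^ 5)) :=
  tendsto_ratio_of_bracket vR vR_rec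
    (fun n hn => ⟨(vR_ratio_bounds n hn).1, (vR_ratio_bounds n hn).2.1⟩)

/-- **Exact growth rate of `vₙ`**: `log vₙ / n → log ((1+√5)/2)⁵`. -/
theorem tendsto_log_v_div :
    Tendsto (fun n : ℕ => Real.log (v n : ℝ) / n) atTop
      (𝓝 (Real.log (((1 + Real.sqrt 5) / 2) ^ 5))) := by
  have hl0 : (0 : ℝ) < ((1 + Real.sqrt 5) / 2) ^ 5 := by
    have := two_lt_sqrt_five; positivity
  have h := tendsto_log_abs_div_of_tendsto_ratio vR 2 (fun n hn => (vR_ratio_bounds n hn).1.ne')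
    hl0.ne' tendsto_ratio_vR
  rw [abs_of_pos hl0] at h
  refine h.congr' ?_
  filter_upwards [eventually_ge_atTop 1] with n hn
  unfold vR; rw [abs_of_pos (by exact_mod_cast v_pos hn)]

/-! ### The first conjunct of `Zudilin2003.rates`, as a theorem -/

/-- From `log wₙ / n → log λ` (`wₙ, λ > 0`) to `wₙ^{1/n} → λ`. -/
theorem tendsto_root_of_tendsto_log_div (w : ℕ → ℝ) {lam : ℝ} (hlam : 0 < lam)
    (hpos : ∀ n, 1 ≤ n → 0 < w n)
    (h : Tendsto (fun n : ℕ => Real.log (w n) / n) atTop (𝓝 (Real.log lam))) :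
    Tendsto (fun n : ℕ => w n ^ (1 / (n : ℝ))) atTop (𝓝 lam) := by
  have h1 : Tendsto (fun n : ℕ => Real.exp (Real.log (w n) / n)) atTop (𝓝 (Real.exp (Real.log lam))) :=
    (Real.continuous_exp.tendsto _).comp h
  rw [Real.exp_log hlam] at h1
  refine h1.congr' ?_
  filter_upwards [eventually_ge_atTop 1] with n hn
  rw [Real.rpow_def_of_pos (hpos n hn)]
  congr 1
  ring

/-- **Zudilin 2003, the growth rate stated after Theorem 1 — PROVED**: `uₙ^{1/n} → ((1+√5)/2)⁵`,
literally the first conjunct of the tree's named fact `Zudilin2003.rates` (now unconditional; the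
non-vanishing and decay conjuncts remain cited). -/
theorem tendsto_root_u :
    Tendsto (fun n : ℕ => ((u n : ℚ) : ℝ) ^ (1 / (n : ℝ))) atTop
      (𝓝 (((1 + Real.sqrt 5) / 2) ^ 5)) := by
  have hl0 : (0 : ℝ) < ((1 + Real.sqrt 5) / 2) ^ 5 := by
    have := two_lt_sqrt_five; positivity
  exact tendsto_root_of_tendsto_log_div (fun n => (u n : ℝ)) hl0 (fun n _ => uR_pos n)
    tendsto_log_u_div

/-- The same for the numerators: `vₙ^{1/n} → ((1+√5)/2)⁵`. -/
theorem tendsto_root_v :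
    Tendsto (fun n : ℕ => ((v n : ℚ) : ℝ) ^ (1 / (n : ℝ))) atTop
      (𝓝 (((1 + Real.sqrt 5) / 2) ^ 5)) := by
  have hl0 : (0 : ℝ) < ((1 + Real.sqrt 5) / 2) ^ 5 := by
    have := two_lt_sqrt_five; positivity
  exact tendsto_root_of_tendsto_log_div (fun n => (v n : ℝ)) hl0 (fun n hn => vR_pos hn)
    tendsto_log_v_div

end Zudilin2003Growth

end Summit.KontsevichZagierPeriods.Zeta5Search
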